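import Literature.Probability.RandomPlanarGeometry.HexSAWPolygonStepTwoOmega
import Literature.Probability.RandomPlanarGeometry.HexSAWPolygonCellsOmegaInjSkeleton
import HarnessLib

/-!
# The step two `q_N(ℍ) ≤ q_{N+2}(ℍ)` modulo the two CASE-2 readings of THEOREM I

Topic `Literature/Probability/RandomPlanarGeometry` (lane «pcv-sawmu», a-p4 g22; sequel of XXXII `HexSAWPolygonStepTwoOmega`
(`hexPolygonNumber_le_add_two_of_omega_injective`) and XXXIX `…CellsOmegaInjSkeleton` (`omegaImage_injective_of_readings`)).

★★★ `hexPolygonNumber_le_add_two_of_readings` — for even `N ≥ 12`, `hexPolygonNumber N ≤ hexPolygonNumber (N + 2)` follows from the two remaining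
reading lemmas of the decoder (hypotheses (R2), (R3), inlined — edition 1 names them `Case2Reading` / `Case1Exclusive` in XXXIX; THEOREM-OMEGA-g21 §4 CASE 2 and the leaf/RU-walk discriminator). Everything else
of the Madras–Slade step-two injection transplanted to the honeycomb lattice — the cell ↔ bond-polygon bridge, THEOREM V, the recursion's closed form, peel
stability, CASE 1 of THEOREM I, the counting over `canonEnd` — is proved in the chain XVII–XXXIX.

Sources: N. Madras, G. Slade, *The Self-Avoiding Walk* (1993), §3.2, Theorem 3.2.3 (3.2.3) and its proof [MadrasSlade1993]; I. Jensen, J. Phys.: Conf. Ser.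
42 (2006) 163 [Jensen2006HoneycombPolygons].  Label (lane): LANE THEOREM (conditional form of the lane target `hexPolygonNumber_le_add_two`); nothing new in writing.
-/

open Finset

namespace Literature.Probability.RandomPlanarGeometry.SAW

namespace HexCell

open HexBW

/-- ★★★ **`q_N ≤ q_{N+2}` for even `N ≥ 12`, modulo the CASE-2 readings (R2) and the exclusivity (R3) of THEOREM I.**
[cite: MadrasSlade1993, §3.2, Theorem 3.2.3 (3.2.3) p. 64, transplanted to `ℍ`] -/
theorem hexPolygonNumber_le_add_two_of_readings
    (hR2 : (∀ S₁ S₂ : Finset Cell, ∀ w : Cell, Adm S₁ → Adm S₂ → omegaImage S₁ = omegaImage S₂ → IsLexmax (omegaImage S₁) w →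
      w ∈ baseImage (peel S₁) →
      (∀ T₁ T₂ : Finset Cell, Adm T₁ → Adm T₂ → #T₁ < #S₁ → omegaImage T₁ = omegaImage T₂ → T₁ = T₂) → S₁ = S₂))
    (hR3 : (∀ S₁ S₂ : Finset Cell, ∀ w : Cell, Adm S₁ → Adm S₂ → omegaImage S₁ = omegaImage S₂ → IsLexmax (omegaImage S₁) w →
      w ∉ baseImage (peel S₁) → w ∉ baseImage (peel S₂)))
    {N : ℕ} (hN : 12 ≤ N) (hE : Even N) :
    hexPolygonNumber N ≤ hexPolygonNumber (N + 2) :=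
  hexPolygonNumber_le_add_two_of_omega_injective hN hE fun S₁ S₂ h₁ h₂ hP₁ hP₂ _ _ h2₁ h2₂ _ _ heq =>
    omegaImage_injective_of_readings hR2 hR3 S₁ S₂ ⟨h₁, hP₁, h2₁⟩ ⟨h₂, hP₂, h2₂⟩ heq

end HexCell

end Literature.Probability.RandomPlanarGeometry.SAW
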